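import Summits.Ventures.HSemireg.WalshParityGeneral

/-!
# Venture HSemireg — LEMMA P for every n, the «if» half of «equality iff» and a minimal design for every n: a design supported on ONE
# letter vector in EACH class of ONE parity family with m(x)·i^{|x|} constant has all mixed moments zero, m̂(+,…,+) = 2^{n−1}·c and
# exactly 2^{n−1} letters — so the bound 2^{n−1} of `WalshParityGeneral.lean` is attained for every n ≥ 1 by an EFFECTIVE design

HONEST FRAMING. Part of the Lean index of the computation cell `pub-hsemireg` (Sunday typer seat p9, § g = 8; family B rows **B20-k** of
`target-g8/CENSUS.md` v1.274 `7744dc4867915f69`: row B20-0 «LADDER of minimal effective W-alive unit-graph designs Z_{2^{n−1}} + cascade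
fillers, n = 1,2,3,4 (1/2/4/8 graphs …)», row B20-3 «LEMMA P bound 2^(n−1)», row B20-4 «LEMMA P, B20-4: minimum 8 at n = 4»). FINITE
GAUSSIAN-INTEGER ARITHMETIC ONLY, continuing `WalshParityGeneral.lean` (same vocabulary `Letter n`, `Sgn n`, `I`, `chi`, `wsign`, `wt`,
`par`, `moment`, `S`). No abelian variety, graph Γ_D, cycle, class or filler is constructed; LEMMA W («class-completable ⟺ all mixed full
moments vanish; W-alive ⟺ m̂(1,…,1) ≠ 0») stays the DICTIONARY — TEXT OF RECORD, not a binder and not proved here; the cascade fillers and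
the numbers q, nnz, resid of row B20-0 are t-20 ∣ t-22 ×2 by machine and are NOT re-derived; nothing here says that HC ∕ HC_CM ∕ HC_AV
holds; no object is certified; no Literature fact is declared.

TEXTS OF RECORD (quoted, not interpreted). Source: t-20, `target-g8/FAMILY-B-G8-t20.md` v1.25 `987a3ee140325c40`, §2.2 LEMMA P, last
sentence: «α ≠ 0 ⇒ at least 2^{n−1} parity classes carry support ⇒ every (effective or signed) class-completable W-alive unit-graph design
has ≥ 2^{n−1} graphs, with equality iff the support is one letter-vector in each class of one parity family with m(x)i^{|x|} constant —
for effective m: m constant and |x| in a fixed residue mod 4.» §2.3: «The minimal designs Z_{2^{n−1}} … x_p := p with, among the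
1-positions of p, a number of 3's ≡ |p|/2 (mod 2) (so |x_p| ≡ 0 mod 4), one for each even-weight p.»

WHAT THIS FILE PROVES (every `n`, or every `n ≥ 1` where the two extreme sign patterns must differ). §1 the FORWARD transform:
`chi_eq_wsign` (i^{ε(δ)·x} = (−1)^{δ·(x mod 2)}·i^{|x|}) and **`moment_eq_sum_S`** (m̂(δ) = Σ_p (−1)^{δ·p}·S_p — «(m̂(ε))_ε is the
Walsh–Hadamard transform of (S_p)_p»). §2 CHARACTER SUMS: `sum_wsign` (Σ_p (−1)^{δ·p} = 2ⁿ·[δ = 0]), `sum_negOnePow_wsign`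
(Σ_p (−1)^{|p|}(−1)^{δ·p} = 2ⁿ·[δ = 1]), **`sum_wsign_family`** (δ mixed ⇒ Σ_{|p| ≡ r} (−1)^{δ·p} = 0 for each parity family r).
§3 THE «IF» HALF: **`moments_of_shape`** — if the support of an integer design `m` on (ℤ∕4)ⁿ (n ≥ 1) meets every class of the parity
family r in EXACTLY ONE letter vector, misses the other family, and `m(x)·i^{|x|} = c` is the same Gaussian integer on the support, then
all 2ⁿ − 2 mixed moments vanish, `m̂(+,…,+) = 2^{n−1}·c`, and the support has exactly 2^{n−1} letter vectors (`S_of_shape`: S_p = c on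
the family, 0 off it). §4 A MINIMAL EFFECTIVE DESIGN FOR EVERY n ≥ 1: `zmin n` = the indicator of the letter vectors x with x_k ∈ {0, 1}
for k ≥ 1 and |x| ≡ 0 (mod 4) (one per even class p: x_p = p read in {0,1}, except that the FIRST letter is raised by 2 — i ↦ −i or
1 ↦ −1 — when |p| ≡ 2 (mod 4); this is a member of t-20's recipe up to WHICH position carries the correction, and at n = 4 it is NOT
letter-for-letter t-20's printed Z₈, which puts no correction on (i,i,i,i)): `zmin_shape` (its support meets each even class exactly once
and no odd class, with m(x)·i^{|x|} = 1) and **`zmin_attains`** (mixed moments 0, m̂(+,…,+) = 2^{n−1} ≠ 0, support = 2^{n−1}): THE BOUND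
OF LEMMA P IS ATTAINED FOR EVERY n ≥ 1 by an effective design with letters in {1, i, −1, −i}; `zmin_attains_four` is the instance n = 4
(m̂ = 8, support 8 — the census's «minimum 8 at n = 4», by the general theorem rather than by enumeration).

WHAT IS NOT HERE. LEMMA W; the cascade fillers ∕ class test of the completed cycles (row B20-0's q, nnz, resid, w); the remaining part of
the «only if» half for general n (that a design attaining 2^{n−1} has exactly one letter per class with m(x)i^{|x|} constant — typed at
n = 4 as `WalshParity.card_eq_eight_shape_even`; its first part, α real or imaginary, is `WalshParityN.re_eq_zero_or_im_eq_zero_of_card_eq`).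
-/

namespace Summit.Ventures.HSemireg.WalshParityN

open Finset

variable {n : ℕ}

/-! ## §1 The forward transform `m̂(δ) = Σ_p (−1)^{δ·p} S_p` -/

/-- `δ·x ≡ δ·(x mod 2) (mod 2)`. -/
theorem dot_mod_two (δ : Sgn n) (x : Letter n) :
    (∑ k, (δ k).val * (x k).val) % 2 = (∑ k, (δ k).val * (par x k).val) % 2 := by
  have h1 : (∑ k, (δ k).val * (x k).val) % 2 = (∑ k, ((δ k).val * (x k).val) % 2) % 2 := Finset.sum_nat_mod _ _ _
  have h2 : (∑ k, (δ k).val * (par x k).val) % 2 = (∑ k, ((δ k).val * (par x k).val) % 2) % 2 :=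
    Finset.sum_nat_mod _ _ _
  rw [h1, h2]
  congr 1
  refine Finset.sum_congr rfl (fun k _ => ?_)
  have hk : (par x k).val = (x k).val % 2 := rfl
  rw [hk, Nat.mul_mod (δ k).val (x k).val 2, Nat.mul_mod (δ k).val ((x k).val % 2) 2, Nat.mod_mod]

/-- The character through the parity class: `i^{ε(δ)·x} = (−1)^{δ·(x mod 2)}·i^{|x|}`. -/
theorem chi_eq_wsign (δ : Sgn n) (x : Letter n) : chi δ x = (wsign δ (par x) : GaussianInt) * I ^ (wt x) := by
  rw [chi_eq, wsign_eq, neg_one_pow_eq_pow_mod_two, dot_mod_two, ← neg_one_pow_eq_pow_mod_two, mul_comm]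

/-- **FORWARD WALSH–HADAMARD TRANSFORM:** `m̂(δ) = Σ_p (−1)^{δ·p}·S_p` for every integer design and every sign pattern («the vector
(m̂(ε))_ε is the Walsh–Hadamard transform of (S_p)_p», §2.2). -/
theorem moment_eq_sum_S (m : Letter n → ℤ) (δ : Sgn n) :
    moment m δ = ∑ p : Sgn n, (wsign δ p : GaussianInt) * S m p := by
  simp only [moment, S, Finset.mul_sum]
  rw [Finset.sum_comm]
  refine Finset.sum_congr rfl (fun x _ => ?_)
  simp_rw [mul_ite, mul_zero]
  rw [Finset.sum_ite_eq, if_pos (Finset.mem_univ _), chi_eq_wsign]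
  ring

/-! ## §2 Character sums over (ℤ∕2)ⁿ and over one parity family -/

/-- `Σ_p (−1)^{δ·p} = 2ⁿ` if `δ = 0` and `0` otherwise. -/
theorem sum_wsign (δ : Sgn n) : (∑ p : Sgn n, (wsign δ p : GaussianInt)) = if δ = 0 then 2 ^ n else 0 := by
  have h : ∀ p : Sgn n, (wsign δ p : GaussianInt) = (-1 : GaussianInt) ^ (∑ k, (p k).val * (δ k).val) := by
    intro p
    rw [wsign_eq, Finset.sum_congr rfl (fun k _ => mul_comm ((δ k).val) ((p k).val))]
  rw [Finset.sum_congr rfl (fun p _ => h p), walsh_sum (fun k => (δ k).val)]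
  have hiff : (∀ k, (δ k).val % 2 = 0) ↔ δ = 0 := by
    constructor
    · intro hall
      funext k
      apply Fin.ext
      have := hall k
      have := (δ k).isLt
      simp only [Pi.zero_apply, Fin.val_zero]
      omega
    · rintro rfl k
      simp
  by_cases hδ : δ = 0
  · rw [if_pos (hiff.mpr hδ), if_pos hδ]
  · rw [if_neg (fun hall => hδ (hiff.mp hall)), if_neg hδ]

/-- `Σ_p (−1)^{|p|}·(−1)^{δ·p} = 2ⁿ` if `δ = 1` (all minus) and `0` otherwise. -/
theorem sum_negOnePow_wsign (δ : Sgn n) :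
    (∑ p : Sgn n, (-1 : GaussianInt) ^ (∑ k, (p k).val) * (wsign δ p : GaussianInt)) = if δ = 1 then 2 ^ n else 0 := by
  have h : ∀ p : Sgn n, (-1 : GaussianInt) ^ (∑ k, (p k).val) * (wsign δ p : GaussianInt)
      = (-1 : GaussianInt) ^ (∑ k, (p k).val * ((δ k).val + 1)) := by
    intro p
    have hsum : (∑ k, (p k).val * ((δ k).val + 1)) = (∑ k, (p k).val) + ∑ k, (δ k).val * (p k).val := by
      rw [← Finset.sum_add_distrib]
      exact Finset.sum_congr rfl (fun k _ => by ring)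
    rw [wsign_eq, hsum, pow_add]
  rw [Finset.sum_congr rfl (fun p _ => h p), walsh_sum (fun k => (δ k).val + 1)]
  have hiff : (∀ k, ((δ k).val + 1) % 2 = 0) ↔ δ = 1 := by
    constructor
    · intro hall
      funext k
      apply Fin.ext
      have := hall k
      have := (δ k).isLt
      simp only [Pi.one_apply, Fin.val_one]
      omega
    · rintro rfl k
      simp
  by_cases hδ : δ = 1
  · rw [if_pos (hiff.mpr hδ), if_pos hδ]
  · rw [if_neg (fun hall => hδ (hiff.mp hall)), if_neg hδ]

/-- **A MIXED CHARACTER SUMS TO ZERO ON EACH PARITY FAMILY:** for `δ ≠ 0, 1` and every residue `r`,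
`Σ_{p : |p| ≡ r (mod 2)} (−1)^{δ·p} = 0` (the even family is the index-2 subgroup of (ℤ∕2)ⁿ whose annihilator is {0, 1}). -/
theorem sum_wsign_family (δ : Sgn n) (hδ0 : δ ≠ 0) (hδ1 : δ ≠ 1) (r : ℕ) :
    (∑ p ∈ Finset.univ.filter (fun p : Sgn n => (∑ k, (p k).val) % 2 = r), (wsign δ p : GaussianInt)) = 0 := by
  set E := ∑ p ∈ Finset.univ.filter (fun p : Sgn n => (∑ k, (p k).val) % 2 = 0), (wsign δ p : GaussianInt) with hE
  set O := ∑ p ∈ Finset.univ.filter (fun p : Sgn n => ¬ (∑ k, (p k).val) % 2 = 0), (wsign δ p : GaussianInt) with hO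
  have hA : E + O = 0 := by
    rw [hE, hO, Finset.sum_filter_add_sum_filter_not, sum_wsign, if_neg hδ0]
  have hB : E - O = 0 := by
    have h := sum_negOnePow_wsign δ
    rw [if_neg hδ1] at h
    have hsplit : (∑ p : Sgn n, (-1 : GaussianInt) ^ (∑ k, (p k).val) * (wsign δ p : GaussianInt))
        = ∑ p : Sgn n, (if (∑ k, (p k).val) % 2 = 0 then (wsign δ p : GaussianInt) else -(wsign δ p : GaussianInt)) := by
      refine Finset.sum_congr rfl (fun p _ => ?_)
      split_ifs with hp
      · rw [(Nat.even_iff.mpr hp).neg_one_pow, one_mul]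
      · rw [(Nat.odd_iff.mpr (by omega)).neg_one_pow, neg_one_mul]
    rw [hsplit, Finset.sum_ite, Finset.sum_neg_distrib] at h
    rw [hE, hO, sub_eq_add_neg]
    exact h
  have hE0 : E = 0 := by
    have h2 : (2 : GaussianInt) * E = 0 := by linear_combination hA + hB
    exact (mul_eq_zero.mp h2).resolve_left two_ne_zero
  have hO0 : O = 0 := by rw [hE0, zero_add] at hA; exact hA
  -- the family r is E (r = 0), O (r = 1) or empty (r ≥ 2)
  by_cases hr0 : r = 0
  · rw [hr0]; exact hE0
  by_cases hr1 : r = 1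
  · rw [hr1]
    have hfilter : Finset.univ.filter (fun p : Sgn n => (∑ k, (p k).val) % 2 = 1)
        = Finset.univ.filter (fun p : Sgn n => ¬ (∑ k, (p k).val) % 2 = 0) :=
      Finset.filter_congr (fun p _ => by omega)
    rw [hfilter]; exact hO0
  · have hfilter : Finset.univ.filter (fun p : Sgn n => (∑ k, (p k).val) % 2 = r) = ∅ :=
      Finset.filter_eq_empty_iff.mpr (fun p _ => by omega)
    rw [hfilter, Finset.sum_empty]

/-! ## §3 The «if» half of «equality iff» -/

/-- The parity-class sums of a design of the extremal shape: `S_p = c` on the chosen family, `S_p = 0` off it. -/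
theorem S_of_shape (m : Letter n → ℤ) (r : ℕ) (c : GaussianInt)
    (hfib : ∀ p : Sgn n, (∑ k, (p k).val) % 2 = r →
      ((Finset.univ.filter (fun x : Letter n => m x ≠ 0)).filter (fun x => par x = p)).card = 1)
    (hout : ∀ x : Letter n, m x ≠ 0 → (∑ k, (par x k).val) % 2 = r)
    (hconst : ∀ x : Letter n, m x ≠ 0 → (m x : GaussianInt) * I ^ (wt x) = c) (p : Sgn n) :
    S m p = if (∑ k, (p k).val) % 2 = r then c else 0 := by
  unfold S
  split_ifs with hp
  · obtain ⟨x₀, hx₀⟩ := Finset.card_eq_one.mp (hfib p hp)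
    have hx₀mem : x₀ ∈ (Finset.univ.filter (fun x : Letter n => m x ≠ 0)).filter (fun x => par x = p) := by
      rw [hx₀]; exact Finset.mem_singleton_self _
    have hm₀ : m x₀ ≠ 0 := (Finset.mem_filter.mp (Finset.mem_filter.mp hx₀mem).1).2
    have hpar₀ : par x₀ = p := (Finset.mem_filter.mp hx₀mem).2
    rw [Finset.sum_eq_single x₀]
    · rw [if_pos hpar₀, hconst x₀ hm₀]
    · intro x _ hx
      by_cases hpx : par x = p
      · have hmx : m x = 0 := by
          by_contra hmx
          have hxmem : x ∈ (Finset.univ.filter (fun x : Letter n => m x ≠ 0)).filter (fun x => par x = p) :=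
            Finset.mem_filter.mpr ⟨Finset.mem_filter.mpr ⟨Finset.mem_univ x, hmx⟩, hpx⟩
          rw [hx₀, Finset.mem_singleton] at hxmem
          exact hx hxmem
        rw [if_pos hpx, hmx]; simp
      · rw [if_neg hpx]
    · intro h; exact absurd (Finset.mem_univ _) h
  · refine Finset.sum_eq_zero (fun x _ => ?_)
    by_cases hpx : par x = p
    · have hmx : m x = 0 := by
        by_contra hmx
        exact hp (hpx ▸ hout x hmx)
      rw [if_pos hpx, hmx]; simp
    · rw [if_neg hpx]

/-- **«EQUALITY IFF», THE «IF» HALF (§2.2, last sentence):** let `m` be an integer design on (ℤ∕4)ⁿ, `n ≥ 1`, whose support meets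
EVERY class of the parity family `r` in EXACTLY ONE letter vector, contains no letter vector of the other family, and on which
`m(x)·i^{|x|} = c` is constant. Then all `2ⁿ − 2` mixed moments vanish (by LEMMA W, quoted not proved: the design is class-completable),
`m̂(+,…,+) = 2^{n−1}·c` (W-alive iff `c ≠ 0`), and the support has exactly `2^{n−1}` letter vectors — the bound of
`two_pow_le_card_support` is attained. -/
theorem moments_of_shape (hn : 0 < n) (m : Letter n → ℤ) (r : ℕ) (hr : r < 2) (c : GaussianInt)
    (hfib : ∀ p : Sgn n, (∑ k, (p k).val) % 2 = r →
      ((Finset.univ.filter (fun x : Letter n => m x ≠ 0)).filter (fun x => par x = p)).card = 1)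
    (hout : ∀ x : Letter n, m x ≠ 0 → (∑ k, (par x k).val) % 2 = r)
    (hconst : ∀ x : Letter n, m x ≠ 0 → (m x : GaussianInt) * I ^ (wt x) = c) :
    (∀ δ : Sgn n, δ ≠ 0 → δ ≠ 1 → moment m δ = 0) ∧ moment m 0 = 2 ^ (n - 1) * c ∧
      (Finset.univ.filter (fun x : Letter n => m x ≠ 0)).card = 2 ^ (n - 1) := by
  obtain ⟨k, rfl⟩ : ∃ k, n = k + 1 := ⟨n - 1, by omega⟩
  set F : Finset (Sgn (k + 1)) := Finset.univ.filter (fun p : Sgn (k + 1) => (∑ i, (p i).val) % 2 = r) with hF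
  have hFcard : F.card = 2 ^ k := card_parityFamily k r hr
  have hS : ∀ p : Sgn (k + 1), S m p = if (∑ i, (p i).val) % 2 = r then c else 0 := S_of_shape m r c hfib hout hconst
  -- every moment is c times a character sum over the family F
  have hmom : ∀ δ : Sgn (k + 1), moment m δ = (∑ p ∈ F, (wsign δ p : GaussianInt)) * c := by
    intro δ
    rw [moment_eq_sum_S, Finset.sum_mul, hF, Finset.sum_filter]
    refine Finset.sum_congr rfl (fun p _ => ?_)
    rw [hS p]
    split_ifs <;> simp
  refine ⟨fun δ hδ0 hδ1 => ?_, ?_, ?_⟩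
  · rw [hmom δ, sum_wsign_family δ hδ0 hδ1 r, zero_mul]
  · have h1 : ∀ p ∈ F, (wsign (0 : Sgn (k + 1)) p : GaussianInt) = 1 := fun p _ => by rw [wsign_zero, Int.cast_one]
    rw [hmom 0, Finset.sum_congr rfl h1, Finset.sum_const, hFcard, Nat.add_sub_cancel]
    simp
  · rw [Finset.card_eq_sum_card_fiberwise (f := par) (t := F)
      (fun x hx => Finset.mem_filter.mpr ⟨Finset.mem_univ _, hout x (Finset.mem_filter.mp hx).2⟩)]
    rw [Finset.sum_congr rfl (fun p hp => hfib p (Finset.mem_filter.mp hp).2), Finset.sum_const, hFcard, Nat.add_sub_cancel]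
    simp

/-! ## §4 A minimal effective design for every n ≥ 1 -/

/-- **A MINIMAL DESIGN FOR EVERY n:** `zmin n` is the indicator (multiplicity 1, so EFFECTIVE) of the letter vectors `x ∈ (ℤ∕4)ⁿ` with
`x_k ∈ {0, 1}` for every `k ≥ 1` and `|x| ≡ 0 (mod 4)`; equivalently one vector `x_p` for each EVEN parity class `p`: `x_p = p` read
with letters `1, i`, except that the first letter is multiplied by `−1` (exponent `+2`) when `|p| ≡ 2 (mod 4)`. A member of t-20's
family of recipes «a number of 3's ≡ |p|/2 (mod 2), so |x_p| ≡ 0 mod 4» up to the position and letter of the correction; not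
letter-for-letter the printed Z₈ at n = 4. [definition of this file] -/
def zmin (n : ℕ) : Letter n → ℤ := fun x =>
  if (∀ k : Fin n, k.val ≠ 0 → (x k).val ≤ 1) ∧ wt x % 4 = 0 then 1 else 0

/-- `zmin` takes only the values 0 and 1 (an effective design of multiplicity one). -/
theorem zmin_eq_zero_or_one (x : Letter n) : zmin n x = 0 ∨ zmin n x = 1 := by
  unfold zmin
  split_ifs
  · exact Or.inr rfl
  · exact Or.inl rfl

/-- Unfolding the support condition of `zmin`. -/
theorem zmin_ne_zero_iff (x : Letter n) : zmin n x ≠ 0 ↔ (∀ k : Fin n, k.val ≠ 0 → (x k).val ≤ 1) ∧ wt x % 4 = 0 := by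
  unfold zmin
  split_ifs with h
  · exact ⟨fun _ => h, fun _ => one_ne_zero⟩
  · exact ⟨fun h0 => absurd rfl h0, fun h' => absurd h' h⟩

/-- `|x mod 2| ≡ |x| (mod 2)`. -/
theorem sum_par_mod_two (x : Letter n) : (∑ k, (par x k).val) % 2 = wt x % 2 := by
  simp only [par, wt]
  rw [← Finset.sum_nat_mod]

/-- The representative `x_p` of an even class `p` in the support of `zmin (k+1)`: `p` itself, with the first exponent raised by 2 when
`|p| ≡ 2 (mod 4)`. [definition of this file] -/
def rep (k : ℕ) (p : Sgn (k + 1)) : Letter (k + 1) := fun i =>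
  if i.val = 0 then ⟨(p i).val + (if (∑ j, (p j).val) % 4 = 2 then 2 else 0), by
      have := (p i).isLt; split_ifs <;> omega⟩
  else ⟨(p i).val, by have := (p i).isLt; omega⟩

/-- `x_p ≡ p (mod 2)`. -/
theorem par_rep (k : ℕ) (p : Sgn (k + 1)) : par (rep k p) = p := by
  funext i
  apply Fin.ext
  simp only [par, rep]
  have := (p i).isLt
  split_ifs <;> simp <;> omega

/-- `|x_p| = |p| + 2·[|p| ≡ 2 (mod 4)]`. -/
theorem wt_rep (k : ℕ) (p : Sgn (k + 1)) :
    wt (rep k p) = (∑ j, (p j).val) + (if (∑ j, (p j).val) % 4 = 2 then 2 else 0) := by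
  simp only [wt]
  rw [Fin.sum_univ_succ]
  have h0 : ((rep k p 0).val) = (p 0).val + (if (∑ j, (p j).val) % 4 = 2 then 2 else 0) := by
    simp [rep]
  have hs : ∀ j : Fin k, (rep k p j.succ).val = (p j.succ).val := by
    intro j
    simp [rep, Fin.val_succ]
  rw [h0, Finset.sum_congr rfl (fun j _ => hs j), Fin.sum_univ_succ (fun j => (p j).val)]
  ring

/-- `x_p` lies in the support of `zmin` when `p` is an even class. -/
theorem zmin_rep_ne_zero (k : ℕ) (p : Sgn (k + 1)) (hp : (∑ j, (p j).val) % 2 = 0) : zmin (k + 1) (rep k p) ≠ 0 := by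
  rw [zmin_ne_zero_iff]
  refine ⟨fun i hi => ?_, ?_⟩
  · have h2 := (p i).isLt
    have hv : (rep k p i).val = (p i).val := by simp [rep, hi]
    rw [hv]
    omega
  · rw [wt_rep]
    split_ifs with h4 <;> omega

/-- A support vector of `zmin` in the class `p` IS `x_p` (uniqueness in each even class). -/
theorem eq_rep_of_zmin_ne_zero (k : ℕ) (p : Sgn (k + 1)) (x : Letter (k + 1)) (hx : zmin (k + 1) x ≠ 0) (hpx : par x = p) :
    x = rep k p := by
  rw [zmin_ne_zero_iff] at hx
  obtain ⟨hsmall, hwt⟩ := hx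
  -- coordinates k ≥ 1 agree: both are 0 or 1 with the same parity
  have htail : ∀ j : Fin k, (x j.succ).val = (p j.succ).val := by
    intro j
    have h1 : (x j.succ).val ≤ 1 := hsmall j.succ (by simp [Fin.val_succ])
    have h2 := congrArg Fin.val (congrFun hpx j.succ)
    simp only [par] at h2
    omega
  -- the first coordinate is forced by |x| ≡ 0 (mod 4)
  have hpar0 := congrArg Fin.val (congrFun hpx 0)
  simp only [par] at hpar0
  have hwt' : wt x = (x 0).val + ∑ j : Fin k, (p j.succ).val := by
    simp only [wt]
    rw [Fin.sum_univ_succ, Finset.sum_congr rfl (fun j _ => htail j)]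
  have hpsum : (∑ j, (p j).val) = (p 0).val + ∑ j : Fin k, (p j.succ).val := Fin.sum_univ_succ _
  funext i
  apply Fin.ext
  by_cases hi : i.val = 0
  · have hi0 : i = 0 := Fin.ext hi
    subst hi0
    simp only [rep, Fin.val_zero, if_true]
    have hx0 := (x 0).isLt
    have hp0 := (p 0).isLt
    rw [hwt'] at hwt
    split_ifs with h4 <;> omega
  · have hi' : i = (i.pred (fun h => hi (by rw [h]; rfl))).succ := (Fin.succ_pred i _).symm
    rw [hi']
    simp only [rep, Fin.val_succ, Nat.succ_ne_zero, if_false]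
    exact htail _

/-- **THE SHAPE OF `zmin`:** its support meets every EVEN parity class in exactly one letter vector, contains no vector of an odd
class, and `m(x)·i^{|x|} = 1` on it. -/
theorem zmin_shape (k : ℕ) :
    (∀ p : Sgn (k + 1), (∑ j, (p j).val) % 2 = 0 →
      ((Finset.univ.filter (fun x : Letter (k + 1) => zmin (k + 1) x ≠ 0)).filter (fun x => par x = p)).card = 1) ∧
    (∀ x : Letter (k + 1), zmin (k + 1) x ≠ 0 → (∑ j, (par x j).val) % 2 = 0) ∧
    (∀ x : Letter (k + 1), zmin (k + 1) x ≠ 0 → (zmin (k + 1) x : GaussianInt) * I ^ (wt x) = 1) := by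
  refine ⟨fun p hp => ?_, fun x hx => ?_, fun x hx => ?_⟩
  · refine Finset.card_eq_one.mpr ⟨rep k p, Finset.eq_singleton_iff_unique_mem.mpr ⟨?_, fun x hx => ?_⟩⟩
    · exact Finset.mem_filter.mpr ⟨Finset.mem_filter.mpr ⟨Finset.mem_univ _, zmin_rep_ne_zero k p hp⟩, par_rep k p⟩
    · exact eq_rep_of_zmin_ne_zero k p x (Finset.mem_filter.mp (Finset.mem_filter.mp hx).1).2 (Finset.mem_filter.mp hx).2
  · rw [sum_par_mod_two]
    have := ((zmin_ne_zero_iff x).mp hx).2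
    omega
  · have h4 := ((zmin_ne_zero_iff x).mp hx).2
    have h1 : zmin (k + 1) x = 1 := (zmin_eq_zero_or_one x).resolve_left hx
    rw [h1, Int.cast_one, one_mul, ← Nat.div_add_mod (wt x) 4, h4, add_zero, pow_mul, I_pow_four, one_pow]

/-- **THE BOUND OF LEMMA P IS ATTAINED FOR EVERY n ≥ 1:** the effective design `zmin (k+1)` on (ℤ∕4)^{k+1} has all `2^{k+1} − 2` mixed
moments zero, `m̂(+,…,+) = 2^k ≠ 0`, and exactly `2^k` letter vectors (row B20-0's ladder 1 ∕ 2 ∕ 4 ∕ 8 at n = 1, 2, 3, 4 continues as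
`2^{n−1}` for every n; the class ∕ filler cells of B20-0 are machine ×2 and NOT re-derived here). -/
theorem zmin_attains (k : ℕ) :
    (∀ δ : Sgn (k + 1), δ ≠ 0 → δ ≠ 1 → moment (zmin (k + 1)) δ = 0) ∧ moment (zmin (k + 1)) 0 = 2 ^ k ∧
      moment (zmin (k + 1)) 0 ≠ 0 ∧ (Finset.univ.filter (fun x : Letter (k + 1) => zmin (k + 1) x ≠ 0)).card = 2 ^ k := by
  obtain ⟨hfib, hout, hconst⟩ := zmin_shape k
  obtain ⟨hmixed, h0, hcard⟩ :=
    moments_of_shape (n := k + 1) (Nat.succ_pos k) (zmin (k + 1)) 0 (by norm_num) 1 hfib hout hconst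
  rw [Nat.add_sub_cancel, mul_one] at h0
  rw [Nat.add_sub_cancel] at hcard
  refine ⟨hmixed, h0, ?_, hcard⟩
  rw [h0]
  exact pow_ne_zero k two_ne_zero

/-- AT THE CENSUS LEVEL n = 4: the effective design `zmin 4` has its 14 mixed moments zero, `m̂(+,+,+,+) = 8` and exactly 8 letter
vectors — a second witness, next to t-20's printed Z₈ (`WalshParity.z8_moments`, kernel `decide`), that «minimum 8 at n = 4» (row B20-4)
is attained; here by the general theorem, not by enumeration. -/
theorem zmin_attains_four :
    (∀ δ : Sgn 4, δ ≠ 0 → δ ≠ 1 → moment (zmin 4) δ = 0) ∧ moment (zmin 4) 0 = 8 ∧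
      (Finset.univ.filter (fun x : Letter 4 => zmin 4 x ≠ 0)).card = 8 := by
  obtain ⟨h1, h2, _, h4⟩ := zmin_attains 3
  refine ⟨h1, ?_, ?_⟩
  · exact h2.trans (by norm_num)
  · exact h4.trans (by norm_num)

end Summit.Ventures.HSemireg.WalshParityN
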